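import Summits.Ventures.PercRepro.CubeSum

/-!
# PercRepro — kernel-decidable connectivity, the computable row, and the integer class sum (typer-2, gen 4)

typer-1's `Decide.lean` decides `G.Conn ω x y` through Mathlib's walk enumeration (≈ 1 s per
query on the farm). For class censuses in the kernel (lead 07:18:52Z: discharge
`LemmaBPlusSimpleUpTo N` by `decide`) a FAST decision procedure is needed:

* `adjB` — open adjacency as a Boolean decided over the edge set; `reachB ω k` — reachability by
  at most `k` open steps, computed by iteration (a `card V × card V` Boolean closure);
* **`reachB_card_eq_true_iff`** — `reachB ω (card V) x y = true ↔ G.Conn ω x y` (every open path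
  shortens to a path of length `< card V`, Mathlib's `IsPath.length_lt` through typer-1's
  `conn_iff_reachable`);
* `rowB` — the computable row of the marked partition, **`rowB_eq_row4`**;
* `kplusZ` — the integer C-011 kernel, `phiPlusKernel_eq_kplusZ`; `cubeSumC011Z` — the integer
  full-cube class sum, **`cubeSumC011_eq_cast`** — so `0 ≤ G.cubeSumC011 m` for a concrete marked
  multigraph is a kernel computation (`decide +kernel`), ≈ 0.45 s per marking on 4 vertices.
-/

namespace PercRepro

open Finset

namespace MultiGraph

variable {V E : Type*} (G : MultiGraph V E) [DecidableEq V] [Fintype E]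

/-- Open adjacency as a computable Boolean. -/
def adjB (ω : Config E) (x y : V) : Bool :=
  decide (∃ e, ω e = true ∧ ((G.fst e = x ∧ G.snd e = y) ∨ (G.fst e = y ∧ G.snd e = x)))

/-- `adjB` decides `OpenAdj`. -/
theorem adjB_eq_true_iff (ω : Config E) (x y : V) : G.adjB ω x y = true ↔ G.OpenAdj ω x y := by
  simp [adjB, OpenAdj]

variable [Fintype V]

/-- Reachability by at most `k` open steps (the first step taken at the start), computed. -/
def reachB (ω : Config E) : ℕ → V → V → Bool
  | 0 => fun x y => decide (x = y)
  | k + 1 => fun x y =>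
      reachB ω k x y || decide (∃ z, G.adjB ω x z = true ∧ reachB ω k z y = true)

/-- Reachability within `k` steps gives connectivity. -/
theorem conn_of_reachB (ω : Config E) :
    ∀ (k : ℕ) (x y : V), G.reachB ω k x y = true → G.Conn ω x y
  | 0, x, y, h => by
    simp only [reachB, decide_eq_true_eq] at h
    subst h
    exact Conn.refl _ _ _
  | k + 1, x, y, h => by
    simp only [reachB, Bool.or_eq_true, decide_eq_true_eq] at h
    rcases h with h | ⟨z, hxz, hzy⟩
    · exact conn_of_reachB ω k x y h
    · exact (Conn.of_openAdj ((G.adjB_eq_true_iff ω x z).mp hxz)).trans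
        (conn_of_reachB ω k z y hzy)

/-- Reachability is monotone in the number of steps. -/
theorem reachB_succ_of (ω : Config E) (k : ℕ) (x y : V) (h : G.reachB ω k x y = true) :
    G.reachB ω (k + 1) x y = true := by
  simp [reachB, h]

/-- Reachability is monotone in the number of steps. -/
theorem reachB_le (ω : Config E) {k l : ℕ} (hkl : k ≤ l) (x y : V)
    (h : G.reachB ω k x y = true) : G.reachB ω l x y = true := by
  induction hkl with
  | refl => exact h
  | step _ ih => exact G.reachB_succ_of ω _ x y ih

/-- A walk of the open subgraph of length `n` gives reachability within `n` steps. -/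
theorem reachB_of_walk (ω : Config E) :
    ∀ {x y : V} (p : (G.openGraph ω).Walk x y), G.reachB ω p.length x y = true
  | _, _, SimpleGraph.Walk.nil => by simp [reachB]
  | _, _, SimpleGraph.Walk.cons hadj p => by
    simp only [SimpleGraph.Walk.length_cons, reachB, Bool.or_eq_true, decide_eq_true_eq]
    right
    refine ⟨_, ?_, reachB_of_walk ω p⟩
    rw [G.adjB_eq_true_iff]
    exact ((SimpleGraph.fromRel_adj _ _ _).1 hadj).2.elim id OpenAdj.symm

/-- **Connectivity is reachability within `card V` steps** (every open path shortens to a path,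
whose length is below the number of vertices). -/
theorem reachB_card_eq_true_iff (ω : Config E) (x y : V) :
    G.reachB ω (Fintype.card V) x y = true ↔ G.Conn ω x y := by
  constructor
  · exact G.conn_of_reachB ω _ x y
  · intro h
    rw [G.conn_iff_reachable] at h
    refine h.elim_path fun p => ?_
    exact G.reachB_le ω (Nat.le_of_lt p.2.length_lt) x y (G.reachB_of_walk ω p.1)

open Classical in
/-- `reachB` at `card V` is the (classical) decision of `Conn`. -/
theorem reachB_card_eq_decide (ω : Config E) (x y : V) :
    G.reachB ω (Fintype.card V) x y = decide (G.Conn ω x y) := by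
  by_cases h : G.Conn ω x y
  · rw [(G.reachB_card_eq_true_iff ω x y).mpr h, decide_eq_true h]
  · rw [decide_eq_false h]
    cases hr : G.reachB ω (Fintype.card V) x y
    · rfl
    · exact absurd ((G.reachB_card_eq_true_iff ω x y).mp hr) h

/-- The computable row of the marked partition of four marks. -/
def rowB (ω : Config E) (m : Fin 4 → V) : Fin 15 :=
  rowOf4 fun a => G.reachB ω (Fintype.card V) (m (pair4 a).1) (m (pair4 a).2)

/-- **The computable row is the row of the marked partition.** -/
theorem rowB_eq_row4 (ω : Config E) (m : Fin 4 → V) :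
    G.rowB ω m = row4 (G.markedPartition ω m) := by
  unfold rowB row4
  congr 1
  funext a
  rw [G.atoms4_markedPartition]
  exact G.reachB_card_eq_decide ω _ _

end MultiGraph

/-- The integer C-011 kernel. -/
def kplusZ (s t : Fin 15) : ℤ :=
  (if s = 0 ∧ t = 14 then 1 else 0) - (∑ q ∈ crossPairs4, if s = q.1 ∧ t = q.2 then 1 else 0) -
    ∑ q ∈ liabPairs4, if s = q.1 ∧ t = q.2 then 1 else 0

/-- The real kernel is the cast of the integer kernel. -/
theorem phiPlusKernel_eq_kplusZ (s t : Fin 15) : phiPlusKernel s t = (kplusZ s t : ℝ) := by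
  simp [phiPlusKernel, kplusZ]

namespace MultiGraph

variable {V E : Type*} (G : MultiGraph V E) [DecidableEq V] [Fintype E] [DecidableEq E] [Fintype V]

/-- The integer full-cube class sum of the C-011 kernel, computed through `rowB`. -/
def cubeSumC011Z (m : Fin 4 → V) : ℤ :=
  ∑ ρ : Config E, kplusZ (G.rowB ρ m) (G.rowB ρᶜ m)

/-- **The real class sum is the cast of the integer one**: `0 ≤ G.cubeSumC011 m` is a kernel
computation on concrete data. -/
theorem cubeSumC011_eq_cast (m : Fin 4 → V) : G.cubeSumC011 m = (G.cubeSumC011Z m : ℝ) := by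
  unfold cubeSumC011 cubeSum cubeSumC011Z
  push_cast
  refine Finset.sum_congr rfl fun ρ _ => ?_
  rw [phiPlusKernel_eq_kplusZ, G.rowB_eq_row4, G.rowB_eq_row4]

/-- `0 ≤ CS` is the integer statement. -/
theorem cubeSumC011_nonneg_iff_Z (m : Fin 4 → V) :
    0 ≤ G.cubeSumC011 m ↔ 0 ≤ G.cubeSumC011Z m := by
  rw [G.cubeSumC011_eq_cast]
  exact_mod_cast Iff.rfl

end MultiGraph

end PercRepro
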